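import Literature.NumberTheory.ComplexMultiplication.FaltingsTateOfPrimitiveCM
import Literature.NumberTheory.ComplexMultiplication.CMStructureIsogenousPrimitivePower
import Literature.AlgebraicGeometry.Motives.FaltingsAbelianBaseChangeDescent
import Literature.AlgebraicGeometry.Motives.FaltingsTateFiniteBiproductAdditivity
import Literature.AlgebraicGeometry.Motives.FaltingsTateBiprodAdditivity
import Literature.AlgebraicGeometry.Motives.AbelianVarietyIsogenyCancellation
import Mathlib.CategoryTheory.Limits.Preserves.Shapes.Biproducts
import HarnessLib

/-!
# [Fal83 §5 Kor. 1] for powers of ANY CM abelian variety over a number field — every CM type, every dimension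

Cell `hodgecm-mathlib`, T5 ledger row (N7b) (A-plan1 g8 00:36:35Z/00:38:45Z; (N7a) = B-p12 g10
★ `CMStructureIsogenousPrimitivePower`; (N2) = ★ `FaltingsTateOfPrimitiveCM`).  Theorems only; no definition, no named
fact (D-0026).

THE PRINT.  [Shimura1998] §6.2 Thm. 3 with §8.2 Prop. 26: an abelian variety of CM type `(K, Φ)` is isogenous to a
power `Bʰ` of an abelian variety of the PRIMITIVE type `(K₁, Φ₁)` from which `Φ` is induced — over a number field after a
finite extension of the ground field (B-p12's ★ `IsCMTypeRealisationOver.exists_isIsogenous_biproduct_primitive`: a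
finite normal `E/k ⊆ ℂ`, a structure `(B, ι_B)` of type `(K₁, Φ₁)` over `E`, `A₀ ⊗ E ∼ ⨁_{Fin h} B`); [Shimura1998]
§13.2 Thm. 2 / ★ (N2) `faltings_tate_bijective_pow_pow_of_isPrimitive_of_thm18_6`: [Fal83 §5 Kor. 1] for powers of a
structure of primitive type; [Faltings1983Endlichkeit] §5 ¶1 «one may extend the ground field, or replace `A` by an
isogenous abelian variety» = ★ `faltings_tate_bijective_of_baseChange_end` (A-p11) + ★ `faltings_tate_bijective_of_isIsogenous`
(A-p02) + Zarhin's corner ★ `faltings_tate_bijective_of_end_biprod`; biproduct additivity ★ (A-p04/A-p05).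

WHAT IS PROVED (granted [Shimura1998, Thm. 18.6] as `h186 : shimura1998_thm18_6`, the tree's ★
`shimura1998_thm18_6_holds` Summits-side): **`faltings_tate_bijective_of_isIsogenous_pow_of_CM_of_thm18_6`** — for a
structure `(A₀, ι₀)` of ANY CM type `(K, Φ)` over a number field `k ⊆ ℂ` (`IsCMTypeRealisationOver`, so `2 dim A₀ = [K:ℚ]`),
every `A ∼ ⨁_{Fin a} A₀`, `B′ ∼ ⨁_{Fin c} A₀` and every prime `ℓ`: `faltings_tate_bijective A B′ ℓ` — the Tate map
`ℤ_ℓ ⊗ Hom_k(A, B′) → Hom_{Γ_k}(T_ℓ A, T_ℓ B′)` is bijective.  Proof: over the finite normal `E/k` of (N7a) both `A ⊗ E`,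
`B′ ⊗ E` are isogenous to powers `⨁_{Fin a} ⨁_{Fin h} B`, `⨁_{Fin c} ⨁_{Fin h} B` of the primitive core (base change is an
additive functor: Mathlib `Functor.mapBiproduct`/`mapBiprod` on ★ `baseChangeFunctor`), so the four Tate maps between
`A ⊗ E`, `B′ ⊗ E` are bijective ((N2) + ★ `faltings_tate_bijective_biproduct_biproduct`), hence the one of
`(A ⊞ B′) ⊗ E ≅ A ⊗ E ⊞ B′ ⊗ E` (★ `faltings_tate_bijective_biprod_biprod`); descend to `k` and take the corner.
HC_CM is proved only modulo the 7 printed citations until rung 0 closes; T5 «distance ledger» capital (books 0): the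
floor row VI-1 [Fal83] is untouched — [Fal83] itself remains the residue for abelian varieties WITHOUT complex
multiplication.

## References
* [Shimura1998] G. Shimura, *Abelian Varieties with Complex Multiplication and Modular Functions* (1998): §6.2 Thm. 3,
  §8.2 Prop. 26, §13.2 Thm. 2, §18.6 Thm. 18.6.
* [Faltings1983Endlichkeit] G. Faltings, Invent. Math. 73 (1983), §5 Satz 4, Korollar 1 and §5 ¶1.
* [Tate1966Endomorphisms] J. Tate, Invent. Math. 2 (1966), §2.
-/

noncomputable section

open scoped NumberField IntermediateField
open NumberField CategoryTheory CategoryTheory.Limits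
open Literature.AlgebraicGeometry.Motives Literature.AlgebraicGeometry.Motives.AbelianVariety

namespace Literature.NumberTheory.ComplexMultiplication

/-- An isomorphism of abelian varieties is an isogeny. [folklore] -/
private theorem isIsogenous_of_iso {k : Type} [Field k] {X Y : AbelianVariety k} (e : X ≅ Y) : IsIsogenous X Y :=
  ⟨e.hom, isIsogeny_hom_of_iso e⟩

/-- **Base change of a power of `A₀` along `k ⊆ E` is isogenous to a power of the primitive core `B`**:
from `A₀ ⊗ E ∼ ⨁_{Fin h} B` and `A ∼ ⨁_{Fin a} A₀` over `k`, `⨁_{Fin a} ⨁_{Fin h} B ∼ A ⊗ E`. [folklore] -/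
private theorem isIsogenous_biproduct_biproduct_baseChange {k : Type} [Field k] (E : Type) [Field E] [CharZero E]
    [Algebra k E]
    {A₀ A : AbelianVariety k} {B : AbelianVariety E} {a h : ℕ}
    (hiso : (⨁ fun _ : Fin h => B).IsIsogenous (A₀.baseChange E)) (hA : IsIsogenous (⨁ fun _ : Fin a => A₀) A) :
    IsIsogenous (⨁ fun _ : Fin a => ⨁ fun _ : Fin h => B) (A.baseChange E) := by
  classical
  have h1 : IsIsogenous (⨁ fun _ : Fin a => ⨁ fun _ : Fin h => B) (⨁ fun _ : Fin a => A₀.baseChange E) :=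
    hiso.biproduct_const
  have h2 : IsIsogenous (⨁ fun _ : Fin a => A₀.baseChange E) ((⨁ fun _ : Fin a => A₀).baseChange E) :=
    isIsogenous_of_iso ((baseChangeFunctor k E).mapBiproduct (fun _ : Fin a => A₀)).symm
  exact h1.trans (h2.trans (hA.baseChange (L := E)))

/-- **(N7b) — [Fal83 §5 Kor. 1] on the isogeny class of powers of ANY CM structure, every `g`**, granted
[Shimura1998, Thm. 18.6] and (N7a): for `(A₀, ι₀)` of CM type `(K, Φ)` over a number field `k ⊆ ℂ`, every
`A ∼ ⨁_{Fin a} A₀`, `B′ ∼ ⨁_{Fin c} A₀` and every prime `ℓ`, `faltings_tate_bijective A B′ ℓ`.  Proof: over the finite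
normal `E/k` of (N7a) both `A ⊗ E`, `B′ ⊗ E` are isogenous to powers of the primitive core `B`, so all four Tate maps
between them are bijective by ★ (N2) + ★ biproduct additivity; `(A ⊞ B′) ⊗ E ≅ A ⊗ E ⊞ B′ ⊗ E` (base change is
additive), hence `End` of `(A ⊞ B′) ⊗ E`; descend to `k` ([Fal83 §5 ¶1], ★ `faltings_tate_bijective_of_baseChange_end`)
and take Zarhin's corner (★ `faltings_tate_bijective_of_end_biprod`).
[cite: Faltings1983Endlichkeit, §5 Korollar 1 and §5 ¶1] [cite: Shimura1998, §6.2 Thm. 3, §8.2 Prop. 26, §13.2 Thm. 2, §18.6 Thm. 18.6] -/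
theorem faltings_tate_bijective_of_isIsogenous_pow_of_CM_of_thm18_6 (h186 : shimura1998_thm18_6)
    {k : Type} [Field k] [NumberField k] [Algebra k ℂ] {K : Type} [Field K] [NumberField K] [IsCMField K]
    (Φ : CMType K) (A₀ : AbelianVariety k) (ι₀ : 𝓞 K →+* CategoryTheory.End A₀) (hA₀ : IsCMTypeRealisationOver Φ A₀ ι₀)
    {a c : ℕ} {A B' : AbelianVariety k} (hAiso : IsIsogenous (⨁ fun _ : Fin a => A₀) A)
    (hBiso : IsIsogenous (⨁ fun _ : Fin c => A₀) B') (ℓ : ℕ) [Fact ℓ.Prime] :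
    faltings_tate_bijective A B' ℓ := by
  classical
  obtain ⟨K₁, Φ₁, hCM, -, hprim, E, hfd, hnorm, B, ιB, hB, h, -, hiso, -⟩ := hA₀.exists_isIsogenous_biproduct_primitive
  haveI : IsCMField K₁ := hCM
  haveI : FiniteDimensional k E := hfd
  haveI : Normal k E := hnorm
  haveI : NumberField E := NumberField.of_module_finite k E
  obtain ⟨φ₀⟩ : Nonempty (K₁ →+* ℂ) := inferInstance
  -- every pair of powers of the primitive core over `E`
  have hcore : ∀ a' c' : ℕ,
      faltings_tate_bijective (⨁ fun _ : Fin a' => ⨁ fun _ : Fin h => B) (⨁ fun _ : Fin c' => ⨁ fun _ : Fin h => B) ℓ :=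
    fun a' c' => faltings_tate_bijective_biproduct_biproduct ℓ _ _ fun _ _ =>
      faltings_tate_bijective_pow_pow_of_isPrimitive_of_thm18_6 h186 Φ₁ B ιB hB (hprim φ₀) h h ℓ
  -- the four Tate maps between `A ⊗ E` and `B′ ⊗ E`
  have hA' := isIsogenous_biproduct_biproduct_baseChange E hiso hAiso
  have hB'' := isIsogenous_biproduct_biproduct_baseChange E hiso hBiso
  have hXY : ∀ {X Y : AbelianVariety E} {a' c' : ℕ},
      IsIsogenous (⨁ fun _ : Fin a' => ⨁ fun _ : Fin h => B) X →
      IsIsogenous (⨁ fun _ : Fin c' => ⨁ fun _ : Fin h => B) Y → faltings_tate_bijective X Y ℓ :=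
    fun hX hY => faltings_tate_bijective_of_isIsogenous ℓ hX hY (hcore _ _)
  -- `End` of `(A ⊞ B′) ⊗ E ≅ A ⊗ E ⊞ B′ ⊗ E`
  haveI := preservesBinaryBiproducts_of_preservesBiproducts (baseChangeFunctor k E)
  have e : (A ⊞ B').baseChange E ≅ A.baseChange E ⊞ B'.baseChange E := (baseChangeFunctor k E).mapBiprod A B'
  have hE : faltings_tate_bijective ((A ⊞ B').baseChange E) ((A ⊞ B').baseChange E) ℓ :=
    faltings_tate_bijective_of_isIsogenous ℓ (isIsogenous_of_iso e.symm) (isIsogenous_of_iso e.symm)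
      (faltings_tate_bijective_biprod_biprod ℓ _ _ _ _ (hXY hA' hA') (hXY hA' hB'') (hXY hB'' hA') (hXY hB'' hB''))
  -- descend to `k` and take the corner
  have hk : faltings_tate_bijective A B' ℓ :=
    faltings_tate_bijective_of_end_biprod A B' ℓ (faltings_tate_bijective_of_baseChange_end E ℓ (A ⊞ B') hE)
  intro _
  exact hk

/-- **[Fal83 §5 Kor. 1] for a CM structure and itself (`End` form; `a = c = 1`)**, granted [Shimura1998, Thm. 18.6]
and (N7a). [cite: Faltings1983Endlichkeit, §5 Satz 4 and Korollar 1] [cite: Shimura1998, §6.2 Thm. 3 and §18.6 Thm. 18.6] -/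
theorem faltings_tate_bijective_self_of_CM_of_thm18_6 (h186 : shimura1998_thm18_6)
    {k : Type} [Field k] [NumberField k] [Algebra k ℂ] {K : Type} [Field K] [NumberField K] [IsCMField K]
    (Φ : CMType K) (A₀ : AbelianVariety k) (ι₀ : 𝓞 K →+* CategoryTheory.End A₀) (hA₀ : IsCMTypeRealisationOver Φ A₀ ι₀)
    (ℓ : ℕ) [Fact ℓ.Prime] : faltings_tate_bijective A₀ A₀ ℓ := by
  have h1 : IsIsogenous (⨁ fun _ : Fin 1 => A₀) A₀ := isIsogenous_of_iso (biproductUniqueIso fun _ : Fin 1 => A₀)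
  have hk : faltings_tate_bijective A₀ A₀ ℓ :=
    faltings_tate_bijective_of_isIsogenous_pow_of_CM_of_thm18_6 h186 Φ A₀ ι₀ hA₀ h1 h1 ℓ
  intro _
  exact hk

end Literature.NumberTheory.ComplexMultiplication

end
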